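import Literature.Probability.Percolation.PercolationProofs
import Summits.CriticalPhenomena.PercolationContinuityZ3.Theorems.AdditiveGluing.Negative.CertSoundness

/-!
# `AdditiveGluing` (crux stmt-CriticalPhenomena-4576, route `PercNearOneGluing`):
# the certified checker for ONE finite graph with arbitrary RATIONAL edge weights

`CertChecker.lean` / `CertSoundness.lean` certify the inequality at density `1/2` on all simple
graphs of a given order.  The crux, however, is a statement about arbitrarily WEIGHTED finite graphs,
and the threat named in the route (gadgets with non-uniform weights) as well as any future witness
live there.  This file makes every such instance Lean-checkable:

* `wsubs l` — the `2^m` sub-configurations of a weighted edge list `l : List (Fin n × Fin n × ℚ)`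
  together with their exact rational weights `∏ (q_e if e open else 1 − q_e)`;
* `wtabs`, `wConn`, `wConnSet`, `wNotConn` — reach tables (from `CertChecker`) and the exact rational
  probabilities `P(o ↔ b)`, `P(o ↔ A)`, `P(a ↮ b)`;
* `agWGraph n l : Bool` — the weights lie in `[0, 1]`, the unordered pairs are distinct, and for all
  `(o, b, A ≠ ∅)`: `∃ a ∈ A, P(o ↔ A) ≤ P(o ↔ b) + P(a ↮ b)`, i.e. the additive gluing inequality
  with the optimal slack `t = max_{a ∈ A} P(a ↮ b)`;
* `prodBernoulli_real_eq_wsum` — under `prodBernoulli (wOfList l)` (weight `q_e` on the listed pairs,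
  `0` elsewhere) the probability of ANY event is the weighted count over `wsubs l`
  (`real_openConn_eq_wConn`, `real_iUnion_openConn_eq_wConnSet`, `real_compl_openConn_eq_wNotConn`);
* `additiveGluing_weighted_of_agWGraph` — **`agWGraph n l = true` implies the additive gluing
  inequality for `prodBernoulli (wOfList l)`, every `A o b` and every admissible `t`.**

So a weighted graph is certified by `theorem foo : agWGraph n l = true := by native_decide`, and —
should a search ever produce a violating weighted graph — the same lemmas evaluate its three
probabilities exactly inside Lean, which is what a `¬ AdditiveGluing` proof would need.  One sample
certificate is included (`agWGraph_tightFamily6`: the asymptotically tight 6-vertex family of the route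
text — `K₅` plus a vertex `b` joined to two of its vertices — at the weight `9/10`).
Nothing here asserts or refutes the crux.
-/

namespace Summit.CriticalPhenomena.PercolationContinuityZ3.Theorems.AdditiveGluing.Negative.Cert

open MeasureTheory
open Literature.Probability.Percolation Literature.Probability.LatticeModels

/-! ### The weighted checker (computable) -/

section Checker

/-- The sub-configurations of a weighted edge list with their weights
`∏_e (q_e if e is kept else 1 − q_e)`. -/
def wsubs {n : ℕ} : List (Fin n × Fin n × ℚ) → List (List (Fin n × Fin n) × ℚ)
  | [] => [([], 1)]
  | e :: l =>
    (wsubs l).map (fun c => (c.1, c.2 * (1 - e.2.2))) ++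
      (wsubs l).map (fun c => ((e.1, e.2.1) :: c.1, c.2 * e.2.2))

/-- Reach tables (see `reachTable`) of all weighted sub-configurations. -/
def wtabs (n : ℕ) (l : List (Fin n × Fin n × ℚ)) : List (List ℕ × ℚ) :=
  (wsubs l).map fun c => (reachTable n c.1, c.2)

/-- `P(o ↔ b)` as an exact rational. -/
def wConn (tabs : List (List ℕ × ℚ)) (o b : ℕ) : ℚ :=
  (tabs.map fun t => if (t.1.getD o 0).testBit b then t.2 else 0).sum

/-- `P(a ↮ b)` as an exact rational. -/
def wNotConn (tabs : List (List ℕ × ℚ)) (a b : ℕ) : ℚ :=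
  (tabs.map fun t => if (t.1.getD a 0).testBit b then 0 else t.2).sum

/-- `P(o ↔ A)` (vertex set `A` as the bit mask `Am`) as an exact rational. -/
def wConnSet (tabs : List (List ℕ × ℚ)) (o Am : ℕ) : ℚ :=
  (tabs.map fun t => if (t.1.getD o 0) &&& Am != 0 then t.2 else 0).sum

/-- The unordered pairs of a weighted edge list. -/
def wPairs {n : ℕ} (l : List (Fin n × Fin n × ℚ)) : List (Sym2 (Fin n)) :=
  l.map fun e => mkE (e.1, e.2.1)

/-- THE WEIGHTED CHECK for one weighted graph: weights in `[0,1]`, distinct unordered pairs, and the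
additive gluing inequality (optimal slack) for every `(o, b, A ≠ ∅)`. -/
def agWGraph (n : ℕ) (l : List (Fin n × Fin n × ℚ)) : Bool :=
  (l.all fun e => decide (0 ≤ e.2.2) && decide (e.2.2 ≤ 1)) && decide (wPairs l).Nodup &&
  (let tabs := wtabs n l
   let cm := (List.range n).map fun o => (List.range n).map fun b => wConn tabs o b
   let dm := (List.range n).map fun a => (List.range n).map fun b => wNotConn tabs a b
   let am := (List.range n).map fun o => (List.range (2 ^ n)).map fun Am => wConnSet tabs o Am
   (List.range n).all fun o => (List.range n).all fun b => (List.range (2 ^ n)).all fun Am =>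
     Am == 0 || (List.range n).any fun a => Am.testBit a &&
       decide ((am.getD o []).getD Am 0 ≤ (cm.getD o []).getD b 0 + (dm.getD a []).getD b 0))

end Checker

/-! ### The weights and the edge set of a weighted edge list -/

/-- The weight function of a weighted edge list: `q_e` (projected to `[0,1]`) on the listed pairs,
`0` on every other pair. -/
noncomputable def wOfList {n : ℕ} : List (Fin n × Fin n × ℚ) → Sym2 (Fin n) → unitInterval
  | [] => fun _ => 0
  | e :: l => fun x => if x = mkE (e.1, e.2.1) then Set.projIcc 0 1 zero_le_one (e.2.2 : ℝ)
      else wOfList l x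

/-- The edge set of a weighted edge list. -/
def wE {n : ℕ} (l : List (Fin n × Fin n × ℚ)) : Finset (Sym2 (Fin n)) := (wPairs l).toFinset

/-- `wE` of a cons. -/
theorem wE_cons {n : ℕ} (e : Fin n × Fin n × ℚ) (l : List (Fin n × Fin n × ℚ)) :
    wE (e :: l) = insert (mkE (e.1, e.2.1)) (wE l) := by
  simp [wE, wPairs]

/-- Off its edge set the weight of a weighted edge list is `0`. -/
theorem wOfList_eq_zero {n : ℕ} : ∀ (l : List (Fin n × Fin n × ℚ)) (x : Sym2 (Fin n)),
    x ∉ wE l → wOfList l x = 0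
  | [], _, _ => rfl
  | e :: l, x, hx => by
    rw [wE_cons, Finset.mem_insert, not_or] at hx
    simp only [wOfList, if_neg hx.1]
    exact wOfList_eq_zero l x hx.2

/-! ### The probability of any event is the weighted count -/

/-- For a parameter vector vanishing off the finite set `E`, the probability of ANY event is the
cylinder sum over the powerset of `E`. -/
theorem prodBernoulli_real_eq_sum_powerset_of_support {ι : Type*} [Fintype ι] [DecidableEq ι]
    (p : ι → unitInterval) (E : Finset ι) (hp : ∀ i ∉ E, p i = 0) (D : Set (Set ι))
    [DecidablePred fun S : Finset ι => (↑S : Set ι) ∈ D] :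
    (prodBernoulli p).real D = ∑ S ∈ E.powerset, if (↑S : Set ι) ∈ D then
      ∏ i ∈ E, (if i ∈ S then (p i : ℝ) else 1 - (p i : ℝ)) else 0 := by
  classical
  have hdet : DeterminedBy D (↑(Finset.univ : Finset ι) : Set ι) := by
    rw [determinedBy_iff]
    intro ω ω' h
    simp only [Finset.coe_univ, Set.inter_univ] at h
    rw [h]
  rw [RussoPath.prodBernoulli_real_eq_sum_powerset hdet p,
    ← Finset.sum_subset (Finset.powerset_mono.2 (Finset.subset_univ E))]
  · refine Finset.sum_congr rfl fun S hS => ?_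
    rw [Finset.mem_powerset] at hS
    by_cases hSD : (↑S : Set ι) ∈ D
    · rw [if_pos hSD, if_pos hSD]
      symm
      refine Finset.prod_subset (Finset.subset_univ E) fun i _ hiE => ?_
      have hiS : i ∉ S := fun h => hiE (hS h)
      simp [hiS, hp i hiE]
    · rw [if_neg hSD, if_neg hSD]
  · intro S _ hS
    rw [Finset.mem_powerset, Finset.not_subset] at hS
    obtain ⟨i, hiS, hiE⟩ := hS
    split_ifs
    · exact Finset.prod_eq_zero (Finset.mem_univ i) (by simp [hiS, hp i hiE])
    · rfl

/-- The weighted count of a function of the edge set over the sub-configurations. -/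
noncomputable def wsum {n : ℕ} (l : List (Fin n × Fin n × ℚ)) (g : Finset (Sym2 (Fin n)) → ℝ) : ℝ :=
  ((wsubs l).map fun c => (c.2 : ℝ) * g (Eset c.1)).sum

/-- `wsum` of the empty list. -/
theorem wsum_nil {n : ℕ} (g : Finset (Sym2 (Fin n)) → ℝ) : wsum [] g = g ∅ := by
  simp [wsum, wsubs, Eset_nil]

/-- The recursion of `wsum`. -/
theorem wsum_cons {n : ℕ} (e : Fin n × Fin n × ℚ) (l : List (Fin n × Fin n × ℚ))
    (g : Finset (Sym2 (Fin n)) → ℝ) :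
    wsum (e :: l) g = (1 - (e.2.2 : ℝ)) * wsum l g +
      (e.2.2 : ℝ) * wsum l (fun S => g (insert (mkE (e.1, e.2.1)) S)) := by
  have h1 : (wsubs l).map ((fun c : List (Fin n × Fin n) × ℚ => (c.2 : ℝ) * g (Eset c.1)) ∘
      fun c => (c.1, c.2 * (1 - e.2.2))) =
      (wsubs l).map fun c => (1 - (e.2.2 : ℝ)) * ((c.2 : ℝ) * g (Eset c.1)) :=
    List.map_congr_left fun c _ => by simp only [Function.comp_apply]; push_cast; ring
  have h2 : (wsubs l).map ((fun c : List (Fin n × Fin n) × ℚ => (c.2 : ℝ) * g (Eset c.1)) ∘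
      fun c => ((e.1, e.2.1) :: c.1, c.2 * e.2.2)) =
      (wsubs l).map fun c => (e.2.2 : ℝ) * ((c.2 : ℝ) * g (insert (mkE (e.1, e.2.1)) (Eset c.1))) :=
    List.map_congr_left fun c _ => by simp only [Function.comp_apply, Eset_cons]; push_cast; ring
  simp only [wsum, wsubs, List.map_append, List.map_map, List.sum_append, h1, h2,
    List.sum_map_mul_left]

/-- **The cylinder sum over the edge set is the weighted count over the sub-configurations**
(induction on the list: `powerset (insert a E) = powerset E ∪ insert a '' powerset E`, and the new
coordinate contributes the factor `1 − q` resp. `q`). -/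
theorem sum_powerset_eq_wsum {n : ℕ} : ∀ (l : List (Fin n × Fin n × ℚ)), (wPairs l).Nodup →
    (∀ e ∈ l, 0 ≤ e.2.2 ∧ e.2.2 ≤ 1) → ∀ g : Finset (Sym2 (Fin n)) → ℝ,
      ∑ S ∈ (wE l).powerset, g S * ∏ i ∈ wE l,
        (if i ∈ S then (wOfList l i : ℝ) else 1 - (wOfList l i : ℝ)) = wsum l g
  | [], _, _, g => by simp [wE, wPairs, wsum_nil]
  | e :: l, hnd, hq, g => by
    rw [wPairs, List.map_cons, List.nodup_cons] at hnd
    have ha : mkE (e.1, e.2.1) ∉ wE l := by simpa [wE, wPairs] using hnd.1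
    have hnd' : (wPairs l).Nodup := hnd.2
    have hq' : ∀ e' ∈ l, 0 ≤ e'.2.2 ∧ e'.2.2 ≤ 1 := fun e' he' => hq e' (List.mem_cons_of_mem _ he')
    have hqe := hq e List.mem_cons_self
    have ih := sum_powerset_eq_wsum l hnd' hq'
    -- the new weight at the new pair, and the old weights elsewhere
    have hwa : (wOfList (e :: l) (mkE (e.1, e.2.1)) : ℝ) = (e.2.2 : ℝ) := by
      simp only [wOfList, if_true]
      rw [Set.projIcc_of_mem _ ⟨by exact_mod_cast hqe.1, by exact_mod_cast hqe.2⟩]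
    have hwi : ∀ i ∈ wE l, wOfList (e :: l) i = wOfList l i := fun i hi => by
      have hne : i ≠ mkE (e.1, e.2.1) := fun h => ha (h ▸ hi)
      simp only [wOfList, if_neg hne]
    have hdisj : Disjoint (wE l).powerset ((wE l).powerset.image (insert (mkE (e.1, e.2.1)))) := by
      rw [Finset.disjoint_left]
      intro S hS hS2
      rw [Finset.mem_powerset] at hS
      rw [Finset.mem_image] at hS2
      obtain ⟨T, _, rfl⟩ := hS2
      exact ha (hS (Finset.mem_insert_self _ _))
    have hinj : Set.InjOn (fun S : Finset (Sym2 (Fin n)) => insert (mkE (e.1, e.2.1)) S)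
        (↑(wE l).powerset : Set (Finset (Sym2 (Fin n)))) := by
      intro S hS T hT hST
      rw [Finset.coe_powerset, Set.mem_preimage, Set.mem_powerset_iff, Finset.coe_subset] at hS hT
      have hS' : mkE (e.1, e.2.1) ∉ S := fun h => ha (hS h)
      have hT' : mkE (e.1, e.2.1) ∉ T := fun h => ha (hT h)
      have hST' : insert (mkE (e.1, e.2.1)) S = insert (mkE (e.1, e.2.1)) T := hST
      rw [← Finset.erase_insert hS', hST', Finset.erase_insert hT']
    rw [wE_cons, Finset.powerset_insert, Finset.sum_union hdisj, Finset.sum_image hinj, wsum_cons,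
      ← ih g, ← ih fun S => g (insert (mkE (e.1, e.2.1)) S), Finset.mul_sum, Finset.mul_sum]
    congr 1
    · refine Finset.sum_congr rfl fun S hS => ?_
      rw [Finset.mem_powerset] at hS
      have haS : mkE (e.1, e.2.1) ∉ S := fun h => ha (hS h)
      have hprod : (∏ i ∈ wE l, (if i ∈ S then (wOfList (e :: l) i : ℝ) else 1 - (wOfList (e :: l) i : ℝ))) =
          ∏ i ∈ wE l, (if i ∈ S then (wOfList l i : ℝ) else 1 - (wOfList l i : ℝ)) :=
        Finset.prod_congr rfl fun i hi => by rw [hwi i hi]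
      rw [Finset.prod_insert ha, if_neg haS, hwa, hprod]
      ring
    · refine Finset.sum_congr rfl fun S _ => ?_
      have hprod : (∏ i ∈ wE l, (if i ∈ insert (mkE (e.1, e.2.1)) S then (wOfList (e :: l) i : ℝ)
            else 1 - (wOfList (e :: l) i : ℝ))) =
          ∏ i ∈ wE l, (if i ∈ S then (wOfList l i : ℝ) else 1 - (wOfList l i : ℝ)) :=
        Finset.prod_congr rfl fun i hi => by
          have hne : i ≠ mkE (e.1, e.2.1) := fun h => ha (h ▸ hi)
          rw [hwi i hi]
          simp only [Finset.mem_insert, hne, false_or]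
      rw [Finset.prod_insert ha, if_pos (Finset.mem_insert_self _ _), hwa, hprod]
      ring

/-- **The probability of any event under the weights of a weighted edge list is the weighted count
of the event over the `2^m` sub-configurations.** -/
theorem prodBernoulli_real_eq_wsum {n : ℕ} {l : List (Fin n × Fin n × ℚ)} (hnd : (wPairs l).Nodup)
    (hq : ∀ e ∈ l, 0 ≤ e.2.2 ∧ e.2.2 ≤ 1) (D : Set (Set (Sym2 (Fin n))))
    [DecidablePred fun S : Finset (Sym2 (Fin n)) => (↑S : Set (Sym2 (Fin n))) ∈ D] :
    (prodBernoulli (wOfList l)).real D =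
      wsum l fun S => if (↑S : Set (Sym2 (Fin n))) ∈ D then 1 else 0 := by
  rw [prodBernoulli_real_eq_sum_powerset_of_support (wOfList l) (wE l) (wOfList_eq_zero l) D,
    ← sum_powerset_eq_wsum l hnd hq]
  refine Finset.sum_congr rfl fun S _ => ?_
  split_ifs <;> simp

/-! ### The three probabilities of the inequality as exact rationals -/

/-- A weighted count of a `Bool` test on the reach tables is the `wsum` of the corresponding event
(test true ↦ weight). -/
theorem cast_sum_wtabs_pos {n : ℕ} (l : List (Fin n × Fin n × ℚ)) (f : List ℕ → Bool)
    (P : Finset (Sym2 (Fin n)) → Prop) [DecidablePred P]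
    (hfP : ∀ ω : List (Fin n × Fin n), f (reachTable n ω) = true ↔ P (Eset ω)) :
    ((((wtabs n l).map fun t => if f t.1 then t.2 else 0).sum : ℚ) : ℝ) =
      wsum l fun S => if P S then (1 : ℝ) else 0 := by
  rw [wsum, wtabs, List.map_map, Rat.cast_list_sum, List.map_map]
  congr 1
  refine List.map_congr_left fun c _ => ?_
  simp only [Function.comp_apply]
  by_cases hP : P (Eset c.1)
  · rw [if_pos ((hfP c.1).2 hP), if_pos hP, mul_one]
  · rw [if_neg (fun h => hP ((hfP c.1).1 h)), if_neg hP, mul_zero, Rat.cast_zero]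

/-- A weighted count of a `Bool` test on the reach tables is the `wsum` of the corresponding event
(test false ↦ weight). -/
theorem cast_sum_wtabs_neg {n : ℕ} (l : List (Fin n × Fin n × ℚ)) (f : List ℕ → Bool)
    (P : Finset (Sym2 (Fin n)) → Prop) [DecidablePred P]
    (hfP : ∀ ω : List (Fin n × Fin n), f (reachTable n ω) = true ↔ P (Eset ω)) :
    ((((wtabs n l).map fun t => if f t.1 then 0 else t.2).sum : ℚ) : ℝ) =
      wsum l fun S => if P S then (0 : ℝ) else 1 := by
  rw [wsum, wtabs, List.map_map, Rat.cast_list_sum, List.map_map]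
  congr 1
  refine List.map_congr_left fun c _ => ?_
  simp only [Function.comp_apply]
  by_cases hP : P (Eset c.1)
  · rw [if_pos ((hfP c.1).2 hP), if_pos hP, mul_zero, Rat.cast_zero]
  · rw [if_neg (fun h => hP ((hfP c.1).1 h)), if_neg hP, mul_one]

/-- `P(o ↔ b) = wConn`. -/
theorem real_openConn_eq_wConn {n : ℕ} {l : List (Fin n × Fin n × ℚ)} (hnd : (wPairs l).Nodup)
    (hq : ∀ e ∈ l, 0 ≤ e.2.2 ∧ e.2.2 ≤ 1) (o b : Fin n) :
    (prodBernoulli (wOfList l)).real (openConn o b) = (wConn (wtabs n l) o b : ℝ) := by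
  classical
  rw [prodBernoulli_real_eq_wsum hnd hq, wConn]
  exact (cast_sum_wtabs_pos l (fun tb => (tb.getD o 0).testBit b)
    (fun S => (↑S : Set (Sym2 (Fin n))) ∈ openConn o b)
    (fun ω => testBit_reachTable_iff_mem_openConn ω o b)).symm

/-- `P(o ↔ A) = wConnSet` (with `A` encoded by `maskL`). -/
theorem real_iUnion_openConn_eq_wConnSet {n : ℕ} {l : List (Fin n × Fin n × ℚ)}
    (hnd : (wPairs l).Nodup) (hq : ∀ e ∈ l, 0 ≤ e.2.2 ∧ e.2.2 ≤ 1) (o : Fin n) (A : Finset (Fin n)) :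
    (prodBernoulli (wOfList l)).real (⋃ a ∈ A, openConn o a) =
      (wConnSet (wtabs n l) o (maskL A.toList) : ℝ) := by
  classical
  rw [prodBernoulli_real_eq_wsum hnd hq, wConnSet]
  exact (cast_sum_wtabs_pos l (fun tb => tb.getD o 0 &&& maskL A.toList != 0)
    (fun S => (↑S : Set (Sym2 (Fin n))) ∈ ⋃ a ∈ A, openConn o a)
    (fun ω => and_maskL_iff_mem_iUnion ω o A)).symm

/-- `P(a ↮ b) = wNotConn`. -/
theorem real_compl_openConn_eq_wNotConn {n : ℕ} {l : List (Fin n × Fin n × ℚ)}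
    (hnd : (wPairs l).Nodup) (hq : ∀ e ∈ l, 0 ≤ e.2.2 ∧ e.2.2 ≤ 1) (a b : Fin n) :
    (prodBernoulli (wOfList l)).real (openConn a b)ᶜ = (wNotConn (wtabs n l) a b : ℝ) := by
  classical
  rw [prodBernoulli_real_eq_wsum hnd hq, wNotConn]
  have h' : (wsum l fun S => if (↑S : Set (Sym2 (Fin n))) ∈ (openConn a b)ᶜ then (1 : ℝ) else 0) =
      wsum l fun S => if (↑S : Set (Sym2 (Fin n))) ∈ openConn a b then (0 : ℝ) else 1 := by
    unfold wsum
    congr 1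
    exact List.map_congr_left fun c _ => by
      simp only [Set.mem_compl_iff]
      split_ifs <;> simp
  rw [h']
  exact (cast_sum_wtabs_neg l (fun tb => (tb.getD a 0).testBit b)
    (fun S => (↑S : Set (Sym2 (Fin n))) ∈ openConn a b)
    (fun ω => testBit_reachTable_iff_mem_openConn ω a b)).symm

/-! ### Soundness of the weighted checker -/

/-- What `agWGraph n l = true` says. -/
theorem agWGraph_spec {n : ℕ} {l : List (Fin n × Fin n × ℚ)} (h : agWGraph n l = true) :
    (∀ e ∈ l, 0 ≤ e.2.2 ∧ e.2.2 ≤ 1) ∧ (wPairs l).Nodup ∧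
      ∀ (o b : Fin n) {Am : ℕ}, Am < 2 ^ n → Am ≠ 0 →
        ∃ a : Fin n, Am.testBit a = true ∧
          wConnSet (wtabs n l) o Am ≤ wConn (wtabs n l) o b + wNotConn (wtabs n l) a b := by
  simp only [agWGraph, Bool.and_eq_true, List.all_eq_true, decide_eq_true_eq, List.mem_range,
    Bool.or_eq_true, beq_iff_eq, List.any_eq_true] at h
  obtain ⟨⟨hq, hnd⟩, hall⟩ := h
  refine ⟨fun e he => hq e he, hnd, fun o b Am hAm hAm0 => ?_⟩
  obtain ⟨a, ha, hta, hle⟩ := (hall o o.2 b b.2 Am hAm).resolve_left hAm0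
  refine ⟨⟨a, ha⟩, hta, ?_⟩
  rw [getD_map_range _ _ o.2, getD_map_range _ _ hAm, getD_map_range _ _ o.2, getD_map_range _ _ b.2,
    getD_map_range _ _ ha, getD_map_range _ _ b.2] at hle
  exact hle

/-- **Soundness of the weighted check.** If `agWGraph n l = true` then the additive gluing
inequality holds for the weighted graph `prodBernoulli (wOfList l)` (weight `q_e` on the listed
pairs, `0` elsewhere), for every relay set `A`, all vertices `o b` and every admissible slack `t`
— an instance of the body of the crux `AdditiveGluing` at `w = wOfList l`. -/
theorem additiveGluing_weighted_of_agWGraph {n : ℕ} {l : List (Fin n × Fin n × ℚ)}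
    (h : agWGraph n l = true) (A : Finset (Fin n)) (o b : Fin n) (t : ℝ) (ht : 0 ≤ t)
    (hrel : ∀ a ∈ A, 1 - t ≤ (prodBernoulli (wOfList l)).real (openConn a b)) :
    (prodBernoulli (wOfList l)).real (⋃ a ∈ A, openConn o a) - t ≤
      (prodBernoulli (wOfList l)).real (openConn o b) := by
  classical
  obtain ⟨hq, hnd, hall⟩ := agWGraph_spec h
  by_cases hA : A = ∅
  · subst hA
    simp only [Finset.notMem_empty, Set.iUnion_of_empty, Set.iUnion_empty, measureReal_empty]
    linarith [measureReal_nonneg (μ := prodBernoulli (wOfList l)) (s := openConn o b)]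
  obtain ⟨a0, ha0⟩ := Finset.nonempty_iff_ne_empty.2 hA
  have hAm0 : maskL A.toList ≠ 0 := by
    intro h0
    have := (testBit_maskL A.toList a0).2 ⟨a0, Finset.mem_toList.2 ha0, rfl⟩
    rw [h0, Nat.zero_testBit] at this
    exact Bool.false_ne_true this
  obtain ⟨a, hta, hle⟩ := hall o b (maskL_lt A.toList) hAm0
  have haA : a ∈ A := by
    obtain ⟨a', ha', haa'⟩ := (testBit_maskL A.toList a).1 hta
    rw [← Fin.ext haa']; exact Finset.mem_toList.1 ha'
  have hcast : (wConnSet (wtabs n l) o (maskL A.toList) : ℝ) ≤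
      wConn (wtabs n l) o b + wNotConn (wtabs n l) a b := by exact_mod_cast hle
  have hcompl : (prodBernoulli (wOfList l)).real (openConn a b)ᶜ =
      1 - (prodBernoulli (wOfList l)).real (openConn a b) :=
    probReal_compl_eq_one_sub (measurableSet_openConn_holds a b)
  have hrel' := hrel a haA
  rw [real_iUnion_openConn_eq_wConnSet hnd hq, real_openConn_eq_wConn hnd hq]
  rw [real_compl_openConn_eq_wNotConn hnd hq] at hcompl
  linarith

/-! ### A sample certificate -/

/-- The asymptotically tight family of the route text at weight `9/10`: `K₅` on `{0,…,4}` and the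
vertex `b = 5` joined to `3` and `4` only (12 edges). -/
def tightFamily6 : List (Fin 6 × Fin 6 × ℚ) :=
  [(0, 1, 9/10), (0, 2, 9/10), (0, 3, 9/10), (0, 4, 9/10), (1, 2, 9/10), (1, 3, 9/10), (1, 4, 9/10),
   (2, 3, 9/10), (2, 4, 9/10), (3, 4, 9/10), (3, 5, 9/10), (4, 5, 9/10)]

/-- The weighted check passes on `tightFamily6` (every `(o, b, A)`; `native_decide`). -/
theorem agWGraph_tightFamily6 : agWGraph 6 tightFamily6 = true := by native_decide

/-- Hence the additive gluing inequality for that weighted graph, all `A o b t`. -/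
theorem additiveGluing_tightFamily6 (A : Finset (Fin 6)) (o b : Fin 6) (t : ℝ) (ht : 0 ≤ t)
    (hrel : ∀ a ∈ A, 1 - t ≤ (prodBernoulli (wOfList tightFamily6)).real (openConn a b)) :
    (prodBernoulli (wOfList tightFamily6)).real (⋃ a ∈ A, openConn o a) - t ≤
      (prodBernoulli (wOfList tightFamily6)).real (openConn o b) :=
  additiveGluing_weighted_of_agWGraph agWGraph_tightFamily6 A o b t ht hrel

end Summit.CriticalPhenomena.PercolationContinuityZ3.Theorems.AdditiveGluing.Negative.Cert
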